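import Mathlib
import Summits.NavierStokesRegularity.NavierStokesRegularity.Theses.RootDecompEternalSpike
import Literature.Analysis.FluidPDE.AncientWeakL3BackwardLiouvilleHolds
import Literature.Analysis.FluidPDE.KNSSThm53OfWindow
import Literature.Analysis.FluidPDE.AncientMildWeak
import Literature.Analysis.FluidPDE.OseenMildUniqueness
import Literature.Analysis.FluidPDE.NSBoundedMildSmoothing

/-!
# N28 «THE ETERNAL SPIKE» — PROVED SECTORS of the residual NEP `NoEternalSpikeProfile` (stmt-33668)

Lens-4 g17 «THE CONSERVED TAIL» (HOME/decomp-ns-lens-4/ConservedTail.lean §6, critic row 166: bank R1–R3 as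
supports of NEP; the NEP♮ split itself was NOT booked).  Three sectors of NEP / WEL are THEOREMS of the tree,
re-proved here in NEP's own currency (eternal bounded mild flow `w`, every translate a duality-form bounded
ancient mild solution at viscosity 1, smooth, uniformly weak-L³ slices):

* R1 `axisymNoSwirl_liouville` — axisymmetric NO-SWIRL enveloped eternal flows vanish (KNSS 2009 Thm 5.2, tree
  `knss2009_axisymmetric_no_swirl_holds`; the envelope kills the constant `β•e_z`);
* R2 `axisym_pointwiseEnvelope_liouville` — axisymmetric eternal flows with `r|w| ≤ C` vanish (KNSS 2009 Thm 5.3,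
  tree `knss_bound_C_over_r_holds`);
* R3 `blowdownNull_liouville` — an enveloped eternal flow in the OSEEN GAUGE with ONE slice in Albritton–Barker's
  class 𝔹 (heat-Besov bound + NULL BLOW-DOWN) vanishes (AB 2019 Thm 4.1, tree
  `AlbrittonBarker2019_liouville_weakL3_backward_holds`, + forward uniqueness `oseenMild_bounded_unique`);

and the three NEP-sector corollaries `noEternalSpikeProfile_sector_*` (a spike has `‖w 0 0‖ = 1`, so it is not
≡ 0).  What NEP asks BEYOND these sectors is the persistent-tail enemy (lens-4 g17 normal form) — open.

Sources: KNSS 2009 (arXiv:0709.3599) Thms 5.2/5.3; Albritton–Barker 2019 (arXiv:1811.00502) Thm 4.1;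
Giga–Inui–Matsui / KNSS §4 (bounded mild uniqueness).
-/

noncomputable section

set_option linter.dupNamespace false

open MeasureTheory Set Function Filter Topology
open scoped NNReal ENNReal RealInnerProductSpace
open Literature.Analysis Literature.Analysis.FluidPDE

namespace Summit.NavierStokesRegularity.NavierStokesRegularity.Theorems.RootDecompEternalSpikeProvedSectors

/-! ## §1 Helpers (lens-4 g16/g17 verbatim) -/

/-- `vol(ℝ³) = ∞`. -/
theorem volume_univ_eq_top : volume (univ : Set (EuclideanSpace ℝ (Fin 3))) = ⊤ :=
  measure_univ_of_isAddLeftInvariant _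

/-- **The envelope kills constants** (g16 verbatim): a constant slice with a weak-`L³` bound is `0`. -/
theorem const_eq_zero_of_envelope {f : EuclideanSpace ℝ (Fin 3) → EuclideanSpace ℝ (Fin 3)}
    {b : EuclideanSpace ℝ (Fin 3)} {M : ℝ≥0∞} (hM : M < ∞)
    (hle : ∀ σ : ℝ, 0 < σ → ENNReal.ofReal σ ^ 3 * volume {y | σ < ‖f y‖} ≤ M)
    (hf : ∀ y, f y = b) : b = 0 := by
  by_contra hb
  have hbpos : 0 < ‖b‖ := norm_pos_iff.2 hb
  have hσ : 0 < ‖b‖ / 2 := by positivity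
  have hset : {y : EuclideanSpace ℝ (Fin 3) | ‖b‖ / 2 < ‖f y‖} = univ := by
    refine eq_univ_of_forall fun y => ?_
    simp only [mem_setOf_eq, hf y]
    linarith
  have h := hle (‖b‖ / 2) hσ
  have hne : ENNReal.ofReal (‖b‖ / 2) ^ 3 ≠ 0 := pow_ne_zero 3 (ENNReal.ofReal_pos.2 hσ).ne'
  rw [hset, volume_univ_eq_top, ENNReal.mul_top hne, top_le_iff] at h
  exact (lt_irrefl (⊤ : ℝ≥0∞)) (h ▸ hM)

/-- Slices of a globally smooth field are continuous. -/
theorem continuous_slice_of_contDiff {w : ℝ → EuclideanSpace ℝ (Fin 3) → EuclideanSpace ℝ (Fin 3)}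
    (hw : ContDiff ℝ (⊤ : ℕ∞) (uncurry w)) (s : ℝ) : Continuous (w s) :=
  hw.continuous.comp (continuous_const.prodMk continuous_id)

/-- Time-translates of a continuous field are continuous. -/
theorem continuous_translate {w : ℝ → EuclideanSpace ℝ (Fin 3) → EuclideanSpace ℝ (Fin 3)}
    (hw : Continuous (uncurry w)) (c : ℝ) : Continuous (uncurry fun s y => w (s + c) y) := by
  have : (uncurry fun s y => w (s + c) y) =
      uncurry w ∘ fun q : ℝ × EuclideanSpace ℝ (Fin 3) => (q.1 + c, q.2) := by
    funext q; rfl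
  rw [this]
  exact hw.comp ((continuous_fst.add continuous_const).prodMk continuous_snd)

/-- **R1 — the AXISYMMETRIC NO-SWIRL sector of WEL is a THEOREM** (KNSS 2009 Thm 5.2, PROVED in the
tree as `knss2009_axisymmetric_no_swirl_holds`: the slices are a.e. `β(t)•e_z`; the envelope kills the
constant).  Boundedness is part of the duality-form class; no Oseen gauge needed. -/
theorem axisymNoSwirl_liouville {w : ℝ → EuclideanSpace ℝ (Fin 3) → EuclideanSpace ℝ (Fin 3)}
    (hmild : (∀ s₀ : ℝ, IsBoundedAncientMildSolution 1 (fun s y => w (s + s₀) y))) (hcd : ContDiff ℝ (⊤ : ℕ∞) (uncurry w)) (henv : (∃ M : ℝ≥0∞, M < ∞ ∧ ∀ s : ℝ, ∀ σ : ℝ, 0 < σ →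
      ENNReal.ofReal σ ^ 3 * volume {y : EuclideanSpace ℝ (Fin 3) | σ < ‖w s y‖} ≤ M))
    (haxi : ∀ s, IsAxisymmetric (w s)) (hsw : ∀ s, HasNoSwirl (w s)) : ∀ s y, w s y = 0 := by
  intro s y
  obtain ⟨M, hM, hle⟩ := henv
  set v : ℝ → EuclideanSpace ℝ (Fin 3) → EuclideanSpace ℝ (Fin 3) := fun t x => w (t + (s + 1)) x
    with hv_def
  have hv : IsBoundedAncientMildSolution 1 v := hmild (s + 1)
  have hvc : Continuous (uncurry v) := continuous_translate hcd.continuous (s + 1)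
  have hjoint : AEStronglyMeasurable (uncurry v)
      ((volume : Measure (ℝ × EuclideanSpace ℝ (Fin 3))).restrict (Iio 0 ×ˢ univ)) :=
    hvc.aestronglyMeasurable
  have hmeas : ∀ t < 0, AEStronglyMeasurable (v t) volume := fun t _ =>
    (continuous_slice_of_contDiff hcd (t + (s + 1))).aestronglyMeasurable
  have haxi' : ∀ t < 0, IsAxisymmetric (v t) := fun t _ => haxi (t + (s + 1))
  have hsw' : ∀ t < 0, HasNoSwirl (v t) := fun t _ => hsw (t + (s + 1))
  obtain ⟨β, hβ⟩ := knss2009_axisymmetric_no_swirl_holds hv hjoint hmeas haxi' hsw' (-1) (by norm_num)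
  have hconst : v (-1) = fun _ => β • eZ :=
    (Continuous.ae_eq_iff_eq volume (continuous_slice_of_contDiff hcd ((-1) + (s + 1)))
      continuous_const).1 hβ
  have hb0 : β • eZ = 0 :=
    const_eq_zero_of_envelope hM (hle ((-1) + (s + 1))) fun x => congrFun hconst x
  have e : (-1 : ℝ) + (s + 1) = s := by ring
  have h1 : w s y = v (-1) y := by simp only [hv_def, e]
  rw [h1, congrFun hconst y, hb0]

/-- **R2 — the AXISYMMETRIC sector WITH SWIRL under the pointwise envelope `r‖w‖ ≤ C` is a THEOREM**
(KNSS 2009 Thm 5.3, PROVED in the tree, duality form `knss_bound_C_over_r_holds`).  (The weak-`L³`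
envelope is not even used: this sector of 18161/WEL is closed outright.) -/
theorem axisym_pointwiseEnvelope_liouville {w : ℝ → EuclideanSpace ℝ (Fin 3) → EuclideanSpace ℝ (Fin 3)}
    (hmild : (∀ s₀ : ℝ, IsBoundedAncientMildSolution 1 (fun s y => w (s + s₀) y))) (hcd : ContDiff ℝ (⊤ : ℕ∞) (uncurry w)) (haxi : ∀ s, IsAxisymmetric (w s))
    (hb : ∃ C : ℝ, ∀ s x, cylRadius x * ‖w s x‖ ≤ C) : ∀ s y, w s y = 0 := by
  intro s y
  obtain ⟨C, hC⟩ := hb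
  set v : ℝ → EuclideanSpace ℝ (Fin 3) → EuclideanSpace ℝ (Fin 3) := fun t x => w (t + (s + 1)) x
    with hv_def
  have hv : IsBoundedAncientMildSolution 1 v := hmild (s + 1)
  have hmeas : ∀ t < 0, AEStronglyMeasurable (v t) volume := fun t _ =>
    (continuous_slice_of_contDiff hcd (t + (s + 1))).aestronglyMeasurable
  have haxi' : ∀ t < 0, IsAxisymmetric (v t) := fun t _ => haxi (t + (s + 1))
  have hb' : ∃ C : ℝ, ∀ t < 0, ∀ x, cylRadius x * ‖v t x‖ ≤ C := ⟨C, fun t _ x => hC (t + (s + 1)) x⟩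
  have hae := knss_bound_C_over_r_holds hv hmeas haxi' hb' (-1) (by norm_num)
  have hconst : v (-1) = (0 : EuclideanSpace ℝ (Fin 3) → EuclideanSpace ℝ (Fin 3)) :=
    (Continuous.ae_eq_iff_eq volume (continuous_slice_of_contDiff hcd ((-1) + (s + 1)))
      continuous_const).1 hae
  have e : (-1 : ℝ) + (s + 1) = s := by ring
  have h1 : w s y = v (-1) y := by simp only [hv_def, e]
  rw [h1, congrFun hconst y, Pi.zero_apply]

/-- **Forward uniqueness in the Oseen gauge** (tree `oseenMild_bounded_unique`, KNSS §4 / Giga–Inui–Matsui):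
a continuous bounded Oseen-eternal flow with ONE zero slice vanishes at all later times. -/
theorem eq_zero_after_of_slice_zero {w : ℝ → EuclideanSpace ℝ (Fin 3) → EuclideanSpace ℝ (Fin 3)}
    (hcont : Continuous (uncurry w)) (hbdd : ∃ C : ℝ, ∀ s y, ‖w s y‖ ≤ C) (hos : (∀ s t : ℝ, s < t → ∀ x,
      w t x = UnboundedOperators.heatExtension (w s) (t - s) x - oseenDuhamel 1 s w w t x))
    {s₀ : ℝ} (h0 : ∀ x, w s₀ x = 0) : ∀ t, s₀ ≤ t → ∀ x, w t x = 0 := by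
  intro t ht x
  rcases eq_or_lt_of_le ht with rfl | hlt
  · exact h0 x
  obtain ⟨C, hC⟩ := hbdd
  have hC0 : 0 ≤ max C 0 := le_max_right _ _
  have hws₀ : w s₀ = fun _ => (0 : EuclideanSpace ℝ (Fin 3)) := funext h0
  set T : ℝ := t + 1 with hT
  set U : ℝ → EuclideanSpace ℝ (Fin 3) → EuclideanSpace ℝ (Fin 3) :=
    fun τ z => UnboundedOperators.heatExtension (w s₀) (τ - s₀) z with hU
  have hU0 : ∀ τ z, U τ z = 0 := by
    intro τ z
    simp only [hU, hws₀, UnboundedOperators.heatExtension_zero_fun, Pi.zero_apply]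
  have hum : AEStronglyMeasurable (uncurry w)
      ((volume : Measure (ℝ × EuclideanSpace ℝ (Fin 3))).restrict (Ioo s₀ T ×ˢ univ)) :=
    hcont.aestronglyMeasurable
  have hvm : AEStronglyMeasurable (uncurry (0 : ℝ → EuclideanSpace ℝ (Fin 3) → EuclideanSpace ℝ (Fin 3)))
      ((volume : Measure (ℝ × EuclideanSpace ℝ (Fin 3))).restrict (Ioo s₀ T ×ˢ univ)) :=
    aestronglyMeasurable_const
  have huM : ∀ τ ∈ Ioo s₀ T, ∀ z, ‖w τ z‖ ≤ max C 0 := fun τ _ z => (hC τ z).trans (le_max_left _ _)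
  have hvM : ∀ τ ∈ Ioo s₀ T, ∀ z,
      ‖(0 : ℝ → EuclideanSpace ℝ (Fin 3) → EuclideanSpace ℝ (Fin 3)) τ z‖ ≤ max C 0 := by
    intro τ _ z; simp [hC0]
  have hu : ∀ τ ∈ Ioo s₀ T, w τ =ᵐ[volume] fun z => U τ z - oseenDuhamel 1 s₀ w w τ z :=
    fun τ hτ => Eventually.of_forall fun z => hos s₀ τ hτ.1 z
  have hv : ∀ τ ∈ Ioo s₀ T, (0 : ℝ → EuclideanSpace ℝ (Fin 3) → EuclideanSpace ℝ (Fin 3)) τ =ᵐ[volume]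
      fun z => U τ z - oseenDuhamel 1 s₀ (0 : ℝ → EuclideanSpace ℝ (Fin 3) → EuclideanSpace ℝ (Fin 3))
        (0 : ℝ → EuclideanSpace ℝ (Fin 3) → EuclideanSpace ℝ (Fin 3)) τ z := by
    intro τ _
    refine Eventually.of_forall fun z => ?_
    simp only [hU0, oseenDuhamel_zero_left, Pi.zero_apply, sub_zero]
  have hae := oseenMild_bounded_unique one_pos hC0 hum hvm huM hvM hu hv t ⟨hlt, by simp [hT]⟩
  have hslice : Continuous (w t) := hcont.comp (continuous_const.prodMk continuous_id)
  have heq : w t = (0 : ℝ → EuclideanSpace ℝ (Fin 3) → EuclideanSpace ℝ (Fin 3)) t :=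
    (Continuous.ae_eq_iff_eq volume hslice continuous_const).1 hae
  simpa using congrFun heq x

/-- **R3 — ONE SLICE IN ALBRITTON–BARKER'S CLASS `𝔹` KILLS AN ENVELOPED OSEEN-ETERNAL FLOW** (the tree
THEOREM `AlbrittonBarker2019_liouville_weakL3_backward_holds`, AB19 Thm 4.1 with `ε = 0`, time-translated
to an arbitrary slice `s₀` — backward times `s₀ − k − 1` carry the envelope —, then propagated forward by
`eq_zero_after_of_slice_zero`).  `𝔹`: the heat-kernel `Ḃ^{-1}_{∞,∞}` bound `√σ‖e^{σΔ}w(s₀)‖_∞ ≤ A` and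
NULL BLOW-DOWN `∫⟪λ w(s₀)(λx), φ(x)⟫ → 0`.  (For enveloped slices the Besov clause is automatic —
`√σ‖e^{σΔ}g‖_∞ ≤ 1 + (4π)^{-3/2}M/2` by splitting `|g|` at height `σ^{-1/2}` — left to UPT's prover.) -/
theorem blowdownNull_liouville {w : ℝ → EuclideanSpace ℝ (Fin 3) → EuclideanSpace ℝ (Fin 3)}
    (hcont : Continuous (uncurry w)) (hbdd : ∃ C : ℝ, ∀ s y, ‖w s y‖ ≤ C)
    (hdiv : ∀ s, IsWeaklyDivFree (w s)) (hos : (∀ s t : ℝ, s < t → ∀ x,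
      w t x = UnboundedOperators.heatExtension (w s) (t - s) x - oseenDuhamel 1 s w w t x)) (henv : (∃ M : ℝ≥0∞, M < ∞ ∧ ∀ s : ℝ, ∀ σ : ℝ, 0 < σ →
      ENNReal.ofReal σ ^ 3 * volume {y : EuclideanSpace ℝ (Fin 3) | σ < ‖w s y‖} ≤ M)) {s₀ : ℝ}
    (hBesov : ∃ A : ℝ, ∀ σ : ℝ, 0 < σ → ∀ x,
      Real.sqrt σ * ‖UnboundedOperators.heatExtension (w s₀) σ x‖ ≤ A)
    (hnull : ∀ φ : EuclideanSpace ℝ (Fin 3) → EuclideanSpace ℝ (Fin 3),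
      FunctionSpaces.IsTestFunctionOn (⊤ : TopologicalSpace.Opens (EuclideanSpace ℝ (Fin 3))) φ →
        Tendsto (fun lam : ℝ => ∫ x, ⟪lam • w s₀ (lam • x), φ x⟫) atTop (𝓝 0)) :
    ∀ s x, w s x = 0 := by
  obtain ⟨M, hM, hle⟩ := henv
  obtain ⟨C, hC⟩ := hbdd
  set c : ℝ := s₀ + 1 with hc
  set v : ℝ → EuclideanSpace ℝ (Fin 3) → EuclideanSpace ℝ (Fin 3) := fun t x => w (t + c) x with hv_def
  have hvc : Continuous (uncurry v) := continuous_translate hcont c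
  have hvcont : ContinuousOn (uncurry v) (Iio 0 ×ˢ univ) := hvc.continuousOn
  have hvbdd : ∃ C : ℝ, ∀ t < 0, ∀ x, ‖v t x‖ ≤ C := ⟨C, fun t _ x => hC (t + c) x⟩
  have hvdiv : ∀ t < 0, IsWeaklyDivFree (v t) := fun t _ => hdiv (t + c)
  have hvmild : ∀ s t : ℝ, s < t → t < 0 → ∀ x,
      v t x = UnboundedOperators.heatExtension (v s) (t - s) x - oseenDuhamel 1 s v v t x := by
    intro s t hst _ x
    have h := hos (s + c) (t + c) (by linarith) x
    have e1 : t + c - (s + c) = t - s := by ring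
    rw [e1] at h
    rw [hv_def, oseenDuhamel_translate 1 s c w w t x]
    exact h
  have hvenv : ∃ (τ : ℕ → ℝ) (M : ℝ≥0∞), M < ∞ ∧ Tendsto τ atTop atBot ∧ (∀ k, τ k < 0) ∧
      ∀ (k : ℕ) (s : ℝ), 0 < s →
        ENNReal.ofReal s ^ 3 * volume {x : EuclideanSpace ℝ (Fin 3) | s < ‖v (τ k) x‖} ≤ M := by
    refine ⟨fun k => -(k : ℝ) + (-1), M, hM, ?_, fun k => by
      have : (0 : ℝ) ≤ k := Nat.cast_nonneg k
      linarith, fun k σ hσ => hle _ σ hσ⟩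
    exact tendsto_atBot_add_const_right _ _ (tendsto_neg_atTop_atBot.comp tendsto_natCast_atTop_atTop)
  have hv1 : v (-1) = w s₀ := by
    funext x
    simp only [hv_def, hc]
    ring_nf
  have hvBesov : ∃ A : ℝ, ∀ σ : ℝ, 0 < σ → ∀ x,
      Real.sqrt σ * ‖UnboundedOperators.heatExtension (v (-1)) σ x‖ ≤ A := by
    rw [hv1]; exact hBesov
  have hvnull : ∀ φ : EuclideanSpace ℝ (Fin 3) → EuclideanSpace ℝ (Fin 3),
      FunctionSpaces.IsTestFunctionOn (⊤ : TopologicalSpace.Opens (EuclideanSpace ℝ (Fin 3))) φ →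
        Tendsto (fun lam : ℝ => ∫ x, ⟪lam • v (-1) (lam • x), φ x⟫) atTop (𝓝 0) := by
    rw [hv1]; exact hnull
  have hzero := AlbrittonBarker2019_liouville_weakL3_backward_holds hvcont hvbdd hvdiv hvmild hvenv
    (show (-1 : ℝ) < 0 by norm_num) hvBesov hvnull
  -- `w ≡ 0` for `s ≤ s₀`
  have hpast : ∀ s ≤ s₀, ∀ x, w s x = 0 := by
    intro s hs x
    have h := hzero (s - c) (by rw [hc]; linarith) x
    simpa [hv_def] using h
  -- forward in time by uniqueness in the Oseen gauge
  intro s x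
  rcases le_or_gt s s₀ with hs | hs
  · exact hpast s hs x
  · exact eq_zero_after_of_slice_zero hcont ⟨C, hC⟩ hos (hpast s₀ le_rfl) s hs.le x

/-! ## §2 The sectors in NEP's currency (supports of stmt-33668 `RootDecompEternalSpike.NoEternalSpikeProfile`) -/

/-- Eternal mild flows (every translate a duality-form bounded ancient mild solution) have weakly
divergence-free slices. -/
theorem isWeaklyDivFree_of_eternalMild {w : ℝ → EuclideanSpace ℝ (Fin 3) → EuclideanSpace ℝ (Fin 3)}
    (h : ∀ s₀ : ℝ, IsBoundedAncientMildSolution 1 (fun s y => w (s + s₀) y)) (s : ℝ) :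
    IsWeaklyDivFree (w s) := by
  have h1 := (h (s + 1)).1.1 (-1) (by norm_num)
  have e : (-1 : ℝ) + (s + 1) = s := by ring
  simpa [e] using h1

/-- `Iff.rfl` receipt: NEP (stmt-33668) is «no `w` satisfies the spike conjunction used below». -/
theorem noEternalSpikeProfile_iff :
    Summit.NavierStokesRegularity.NavierStokesRegularity.Theses.RootDecompEternalSpike.NoEternalSpikeProfile ↔
      ∀ w : ℝ → EuclideanSpace ℝ (Fin 3) → EuclideanSpace ℝ (Fin 3), ¬ ((∀ s₀ : ℝ, Literature.Analysis.FluidPDE.IsBoundedAncientMildSolution 1 (fun s y => w (s + s₀) y)) ∧ ContDiff ℝ (⊤ : ℕ∞) (Function.uncurry w) ∧ (∀ s ≤ (0 : ℝ), ∀ y : EuclideanSpace ℝ (Fin 3), ‖w s y‖ ≤ 1) ∧ (∀ (s : ℝ) (y : EuclideanSpace ℝ (Fin 3)), ‖w s y‖ ≤ 2) ∧ ‖w 0 0‖ = 1 ∧ (∃ M : ENNReal, M < ⊤ ∧ ∀ s : ℝ, ∀ σ : ℝ, 0 < σ → ENNReal.ofReal σ ^ 3 * MeasureTheory.volume {y :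 EuclideanSpace ℝ (Fin 3) | σ < ‖w s y‖} ≤ M)) :=
  Iff.rfl

/-- **NEP holds on the axisymmetric no-swirl sector** (R1): no enveloped eternal spike profile is
axisymmetric without swirl. -/
theorem noEternalSpikeProfile_sector_axisymNoSwirl
    (w : ℝ → EuclideanSpace ℝ (Fin 3) → EuclideanSpace ℝ (Fin 3))
    (haxi : ∀ s, IsAxisymmetric (w s)) (hsw : ∀ s, HasNoSwirl (w s)) :
    ¬ ((∀ s₀ : ℝ, Literature.Analysis.FluidPDE.IsBoundedAncientMildSolution 1 (fun s y => w (s + s₀) y)) ∧ ContDiff ℝ (⊤ : ℕ∞) (Function.uncurry w) ∧ (∀ s ≤ (0 : ℝ), ∀ y : EuclideanSpace ℝ (Fin 3), ‖w s y‖ ≤ 1) ∧ (∀ (s : ℝ) (y : EuclideanSpace ℝ (Fin 3)), ‖w s y‖ ≤ 2) ∧ ‖w 0 0‖ = 1 ∧ (∃ M : ENNReal, M < ⊤ ∧ ∀ s : ℝ, ∀ σ : ℝ, 0 < σ → ENNReal.ofReal σ ^ 3 * MeasureTheory.volume {y : EuclideanSpace ℝ (Fin 3) | σ < ‖w s y‖}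 ≤ M)) := by
  intro h
  have h0 := axisymNoSwirl_liouville h.1 h.2.1 h.2.2.2.2.2 haxi hsw 0 0
  have h1 := h.2.2.2.2.1
  rw [h0, norm_zero] at h1
  exact zero_ne_one h1

/-- **NEP holds on the axisymmetric `r|w| ≤ C` sector** (R2). -/
theorem noEternalSpikeProfile_sector_axisymPointwiseEnvelope
    (w : ℝ → EuclideanSpace ℝ (Fin 3) → EuclideanSpace ℝ (Fin 3))
    (haxi : ∀ s, IsAxisymmetric (w s)) (hb : ∃ C : ℝ, ∀ s x, cylRadius x * ‖w s x‖ ≤ C) :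
    ¬ ((∀ s₀ : ℝ, Literature.Analysis.FluidPDE.IsBoundedAncientMildSolution 1 (fun s y => w (s + s₀) y)) ∧ ContDiff ℝ (⊤ : ℕ∞) (Function.uncurry w) ∧ (∀ s ≤ (0 : ℝ), ∀ y : EuclideanSpace ℝ (Fin 3), ‖w s y‖ ≤ 1) ∧ (∀ (s : ℝ) (y : EuclideanSpace ℝ (Fin 3)), ‖w s y‖ ≤ 2) ∧ ‖w 0 0‖ = 1 ∧ (∃ M : ENNReal, M < ⊤ ∧ ∀ s : ℝ, ∀ σ : ℝ, 0 < σ → ENNReal.ofReal σ ^ 3 * MeasureTheory.volume {y : EuclideanSpace ℝ (Fin 3) | σ < ‖w s y‖} ≤ M)) := by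
  intro h
  have h0 := axisym_pointwiseEnvelope_liouville h.1 h.2.1 haxi hb 0 0
  have h1 := h.2.2.2.2.1
  rw [h0, norm_zero] at h1
  exact zero_ne_one h1

/-- **NEP holds on the Oseen-gauge sector with ONE slice in Albritton–Barker's class 𝔹** (R3): an
enveloped eternal spike profile in the Oseen gauge has NO slice with a heat-Besov bound and null blow-down
— at every time the `|x|⁻¹` tail is there. -/
theorem noEternalSpikeProfile_sector_nullSlice
    (w : ℝ → EuclideanSpace ℝ (Fin 3) → EuclideanSpace ℝ (Fin 3))
    (hos : ∀ s t : ℝ, s < t → ∀ x,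
      w t x = UnboundedOperators.heatExtension (w s) (t - s) x - oseenDuhamel 1 s w w t x)
    (s₀ : ℝ)
    (hBesov : ∃ A : ℝ, ∀ σ : ℝ, 0 < σ → ∀ x,
      Real.sqrt σ * ‖UnboundedOperators.heatExtension (w s₀) σ x‖ ≤ A)
    (hnull : ∀ φ : EuclideanSpace ℝ (Fin 3) → EuclideanSpace ℝ (Fin 3),
      FunctionSpaces.IsTestFunctionOn (⊤ : TopologicalSpace.Opens (EuclideanSpace ℝ (Fin 3))) φ →
        Tendsto (fun lam : ℝ => ∫ x, ⟪lam • w s₀ (lam • x), φ x⟫) atTop (𝓝 0)) :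
    ¬ ((∀ s₀ : ℝ, Literature.Analysis.FluidPDE.IsBoundedAncientMildSolution 1 (fun s y => w (s + s₀) y)) ∧ ContDiff ℝ (⊤ : ℕ∞) (Function.uncurry w) ∧ (∀ s ≤ (0 : ℝ), ∀ y : EuclideanSpace ℝ (Fin 3), ‖w s y‖ ≤ 1) ∧ (∀ (s : ℝ) (y : EuclideanSpace ℝ (Fin 3)), ‖w s y‖ ≤ 2) ∧ ‖w 0 0‖ = 1 ∧ (∃ M : ENNReal, M < ⊤ ∧ ∀ s : ℝ, ∀ σ : ℝ, 0 < σ → ENNReal.ofReal σ ^ 3 * MeasureTheory.volume {y : EuclideanSpace ℝ (Fin 3) | σ < ‖w s y‖} ≤ M)) := by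
  intro h
  have h0 := blowdownNull_liouville h.2.1.continuous ⟨2, h.2.2.2.1⟩ (isWeaklyDivFree_of_eternalMild h.1)
    hos h.2.2.2.2.2 hBesov hnull 0 0
  have h1 := h.2.2.2.2.1
  rw [h0, norm_zero] at h1
  exact zero_ne_one h1

end Summit.NavierStokesRegularity.NavierStokesRegularity.Theorems.RootDecompEternalSpikeProvedSectors

end
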